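/-
Copyright: the b2b-balaban T⁴-continuum CRUX team, row NE7b OWNER lineage `t4-ne7b-p1` (gen 141). Project licence.
-/
import Summits.QuantumFields.BalabanUV.T4Continuum.Spine.NE7b.SupWhitenedFourthCumulantRowLetter
import Summits.QuantumFields.BalabanUV.T4Continuum.Spine.NE7b.SupFiniteRangeGeometryLetters
import Summits.QuantumFields.BalabanUV.T4Continuum.Spine.NE7b.SupWhitenedNeumannAdmissible

/-!
# THE FOURTH CUMULANT'S ROW LETTER FOR A FINITE-RANGE FACTOR (SCOPING (d13)(2), twelfth file): (498) with every weight INSTANTIATED as in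
# (476) and the admissible `D` := the Neumann series of (485).  Sites placed by `p : ι → X`, sampler indices by `q : κ → X` in one pseudometric
# space; `θ_{zw} = e^{8μd(qz,qw)}`, `σ_{xw} = e^{8μd(px,qw)}` (as (476)) and the ORDER-4 site weight `r_{xy} = e^{(μ∕3)d(px,py)}` — so that
# `r²⁴ = e^{8μd} ≤ σσ` by one triangle inequality; a factor of range `R`, a Hessian majorant of range `R′`.  Then `γθ, γθ′, αθ = βθ` are (476)'s
# plain letters × range factors, `dθ = (1−γθ)⁻¹`, `dθ′ = (1−γθ′)⁻¹` by (485), and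
#   `Σ_yΣ_zΣ_t |u₄(F_x,F_y,F_z,F_t)| ≤ C·16·S³`,   `C = 4K + 3K² + 4M₄ + 4M₆ + 2M₂(M₂+M₄)`,  `K = αθ²(1−γθ)⁻¹(1−γθ′)⁻¹∕(1−lamA)`,
# `M₄ = 5κ₂⁴γ_op²∕(1−λγ_op)²`, `M₂ = (M₄+1)∕2`, with ONLY the sixth-moment letter `M₆`, the site letter `Σ_v e^{−(2μ∕3)d(pu,pv)} ≤ S` and the
# weighted smallness `γθ, γθ′ < 1` left as hypotheses (row NE7b, node U5c; (498), (476), (485) BY NAME; [folklore])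

Cell `pub-balaban`, sub-cell `t4`, spine estimate NE7b (`T4WeightBudget.RelWeightBound`; the cell's OWN estimate — NOT PRINTED in
[Bałaban 1983–89], NOT PROVED).  Crux-route work under `Spine/NE7b/` by the row OWNER (`t4-ne7b-p1` gen 141, file (499)) under FREEZE
(0)'s crux-prover clause; NOTHING of Bałaban's is named as a Lean object, valued or asserted; no `T4Continuum/Support` leaf typed; no
`def`, no notation (weights, `D`, `u₄` WRITTEN OUT); zero `sorry`.  Imports (BY NAME): the OWNER's (498) `…SupWhitenedFourthCumulantRowLetter`,
(476) `…SupFiniteRangeGeometryLetters` (`expw_one_le`, `expw_triangle`, `sigma_theta`, `weighted_cross_rowsum_le`, `weighted_cross_colsum_le`,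
`weighted_obs_rowsum_le`, `weighted_obs_entry_le`), (485) `…SupWhitenedNeumannAdmissible` (`neumannD_nonneg`, `neumannD_dominates`,
`neumannD_weighted_rowsum`, `neumannD_weighted_colsum`).

WHAT IS PROVED ([folklore]): `r_pow_24_le` (`(e^{(μ∕3)d(px,py)})²⁴ ≤ σ_{xw}σ_{yw}`), THE END **`finite_range_fourth_cumulant_row_letter`**; toy.

HONEST (what this is NOT).  The cumulant piece's row letter at order 4 for a finite-range factor, `M₆` and `S` letters; the other pieces of
`∂⁴W`, its cumulant form and assembly are NOT typed; scalar skeleton ((A3), NC-NE7b-α UNRULED); nothing of Bałaban's asserted.  BY-NAME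
EFFECT ON THE WALL: NONE.  NE7b NOT PRINTED ∕ NOT PROVED; spine PROVED 0∕9; rung (B)+1 — the programme's measures remain FINITE-torus
statements; NOT the mass gap, NOT Clay.  HONEST DEPENDENCY: continuum YM on T⁴ ⇐ BetaPertH ∧ nine spine estimates (0∕9 proved); BetaPertH
⇐ (D1) ∧ (D4) ∧ CAP+tail; G-an2-4 gates asym, D1 and NE2∕3∕4.
-/

set_option autoImplicit false
set_option maxSynthPendingDepth 2

noncomputable section

namespace Summit.QuantumFields.BalabanUV.T4Continuum.NE7b.SupFiniteRangeFourthCumulant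

open MeasureTheory ProbabilityTheory Real Set Function Finset Matrix
open scoped BigOperators
open Literature.Probability.Distributions (matrixCLM)
open SupWhitenedFourthCumulantRowLetter (whitened_fourth_cumulant_row_letter)
open SupFiniteRangeGeometryLetters (expw_one_le expw_triangle sigma_theta weighted_cross_rowsum_le weighted_cross_colsum_le
  weighted_obs_rowsum_le weighted_obs_entry_le)
open SupWhitenedNeumannAdmissible (neumannD_nonneg neumannD_dominates neumannD_weighted_rowsum neumannD_weighted_colsum)
open SupWhitenedFirstOrderLetters (whitened_obs_nonneg whitened_cross_nonneg)

variable {ι κ X : Type} [Fintype ι] [DecidableEq ι] [Fintype κ] [DecidableEq κ] [PseudoMetricSpace X]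

/-! ## §1. The order-4 site weight -/

omit [Fintype ι] [DecidableEq ι] [Fintype κ] [DecidableEq κ] in
/-- **`r²⁴ ≤ σσ`**: `(e^{(μ∕3)d(px,py)})²⁴ = e^{8μd(px,py)} ≤ e^{8μd(px,qw)}·e^{8μd(py,qw)}` for `μ ≥ 0`. [folklore] -/
theorem r_pow_24_le {μ : ℝ} (hμ : 0 ≤ μ) (p : ι → X) (q : κ → X) (x y : ι) (w : κ) :
    Real.exp (μ / 3 * dist (p x) (p y)) ^ 24 ≤ Real.exp (8 * μ * dist (p x) (q w)) * Real.exp (8 * μ * dist (p y) (q w)) := by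
  rw [← Real.exp_nat_mul, dist_comm (p y) (q w)]
  have e : ((24 : ℕ) : ℝ) * (μ / 3 * dist (p x) (p y)) = 8 * μ * dist (p x) (p y) := by push_cast; ring
  rw [e]
  exact expw_triangle (by linarith) (p x) (q w) (p y)

/-! ## §2. THE END: the row letter for a finite-range factor -/

variable {U : EuclideanSpace ℝ ι → ℝ} {U' : EuclideanSpace ℝ ι → EuclideanSpace ℝ ι →L[ℝ] ℝ}
  {U'' : EuclideanSpace ℝ ι → EuclideanSpace ℝ ι →L[ℝ] EuclideanSpace ℝ ι →L[ℝ] ℝ} {Hk : ι → ι → ℝ} {A : Matrix ι κ ℝ} {p : ι → X} {q : κ → X}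
  {γop κ₀ κ₁ κ₂ a τ δ θp lam lamA αr αc hr hc γ μ R R' M₆ S : ℝ}

/-- **THE END — THE FOURTH CUMULANT'S ROW LETTER FOR A FINITE-RANGE FACTOR** (`M₆`, `S` letters; the weighted smallness `γθ, γθ′ < 1` a
hypothesis on plain letters × range factors). [folklore] -/
theorem finite_range_fourth_cumulant_row_letter [Nonempty κ] (hΓop : (γop • (1 : Matrix ι ι ℝ) - A * Aᵀ).PosSemidef) (Y : Finset ι)
    (hUd : ∀ φ : EuclideanSpace ℝ ι, HasFDerivAt U (U' φ) φ) (hU'd : ∀ φ : EuclideanSpace ℝ ι, HasFDerivAt U' (U'' φ) φ)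
    (hU''c : Continuous U'') (hκ₀ : 0 ≤ κ₀) (hκ₁ : 0 ≤ κ₁) (ha : 0 ≤ a) (hτ : 0 < τ) (hδ : 0 < δ) (hθ0 : 0 < θp) (hθ1 : θp < 1)
    (hκθ : (2 * κ₀ * (1 + τ) + 4 * δ) * γop ≤ θp) (hκθw : 2 * κ₀ * (1 + τ) * γop + 4 * δ ≤ θp)
    (hstab : ∀ φ : EuclideanSpace ℝ ι, -(κ₀ * ∑ x ∈ Y, φ x ^ 2) ≤ U φ)
    (hU'b : ∀ φ : EuclideanSpace ℝ ι, ‖U' φ‖ ≤ κ₁ * (a + ∑ x ∈ Y, φ x ^ 2)) (hU''b : ∀ φ : EuclideanSpace ℝ ι, ‖U'' φ‖ ≤ κ₂) (hlam : 0 ≤ lam)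
    (hUsec : ∀ s : ℝ, 0 ≤ s → s ≤ 1 → ∀ a b : EuclideanSpace ℝ ι,
      U ((1 - s) • a + s • b) - lam / 2 * (s * (1 - s)) * ∑ i, (a i - b i) ^ 2 ≤ (1 - s) * U a + s * U b)
    (hρg : lam * γop < 1)
    (hHk : ∀ (φ : EuclideanSpace ℝ ι) (x z : ι), |U'' φ (EuclideanSpace.single z (1 : ℝ)) (EuclideanSpace.single x (1 : ℝ))| ≤ Hk x z)
    (hHk0 : ∀ v u, 0 ≤ Hk v u) (ψ : EuclideanSpace ℝ ι)
    (hαr : ∀ u, ∑ w, |A u w| ≤ αr) (hαc : ∀ w, ∑ u, |A u w| ≤ αc) (hhr : ∀ v, ∑ u, Hk v u ≤ hr) (hhc : ∀ u, ∑ v, Hk v u ≤ hc)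
    (hlamA : ∀ x : κ, ∑ u, ∑ v, |A u x| * |A v x| * Hk v u ≤ lamA) (hlamA1 : lamA < 1) (hγ : αc * hr * αr / (1 - lamA) ≤ γ) (hγ1 : γ < 1)
    -- the geometry: placements, rate, ranges, the weighted smallness
    (hμ : 0 ≤ μ) (hAR : ∀ u w, A u w = 0 ∨ dist (p u) (q w) ≤ R) (hHkR : ∀ v u, Hk v u = 0 ∨ dist (p v) (p u) ≤ R')
    (hγθ1 : (Real.exp (8 * μ * (2 * R + R')) * (αc * hr * αr) / (1 - lamA)) < 1) (hγθ'1 : (Real.exp (8 * μ * (2 * R + R')) * (αc * hc * αr) / (1 -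
        lamA)) < 1)
    -- the sixth-moment letter and the site letter
    (hI6 : ∀ (v : ι) (c : ℝ), Integrable (fun z : κ → ℝ => (U' (matrixCLM A (WithLp.toLp 2 z) + ψ) (EuclideanSpace.single v (1 : ℝ)) - c) ^ 6)
        ((volume : Measure (κ → ℝ)).tilted fun z => -(1 / 2 * (z ⬝ᵥ z) + U (matrixCLM A (WithLp.toLp 2 z) + ψ))))
    (hM6 : ∀ v : ι, ∫ w, (U' (matrixCLM A (WithLp.toLp 2 w) + ψ) (EuclideanSpace.single v (1 : ℝ)) - (∫ w', U' (matrixCLM A (WithLp.toLp 2 w') + ψ)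
        (EuclideanSpace.single v (1 : ℝ)) ∂((volume : Measure (κ → ℝ)).tilted fun z => -(1 / 2 * (z ⬝ᵥ z) + U (matrixCLM A (WithLp.toLp 2 z) + ψ)))))
        ^ 6 ∂((volume : Measure (κ → ℝ)).tilted fun z => -(1 / 2 * (z ⬝ᵥ z) + U (matrixCLM A (WithLp.toLp 2 z) + ψ))) ≤ M₆)
    (hS : ∀ u, ∑ v, (Real.exp (μ / 3 * dist (p u) (p v)) ^ 2)⁻¹ ≤ S) (x : ι) :
    ∑ y, ∑ z, ∑ t, |(∫ w, (U' (matrixCLM A (WithLp.toLp 2 w) + ψ) (EuclideanSpace.single x (1 : ℝ)) - (∫ w', U' (matrixCLM A (WithLp.toLp 2 w') + ψ)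
        (EuclideanSpace.single x (1 : ℝ)) ∂((volume : Measure (κ → ℝ)).tilted fun z => -(1 / 2 * (z ⬝ᵥ z) + U (matrixCLM A (WithLp.toLp 2 z) + ψ)))))
        * (U' (matrixCLM A (WithLp.toLp 2 w) + ψ) (EuclideanSpace.single y (1 : ℝ)) - (∫ w', U' (matrixCLM A (WithLp.toLp 2 w') + ψ)
        (EuclideanSpace.single y (1 : ℝ)) ∂((volume : Measure (κ → ℝ)).tilted fun z => -(1 / 2 * (z ⬝ᵥ z) + U (matrixCLM A (WithLp.toLp 2 z) + ψ)))))
        * (U' (matrixCLM A (WithLp.toLp 2 w) + ψ) (EuclideanSpace.single z (1 : ℝ)) - (∫ w', U' (matrixCLM A (WithLp.toLp 2 w') + ψ)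
        (EuclideanSpace.single z (1 : ℝ)) ∂((volume : Measure (κ → ℝ)).tilted fun z => -(1 / 2 * (z ⬝ᵥ z) + U (matrixCLM A (WithLp.toLp 2 z) + ψ)))))
        * (U' (matrixCLM A (WithLp.toLp 2 w) + ψ) (EuclideanSpace.single t (1 : ℝ)) - (∫ w', U' (matrixCLM A (WithLp.toLp 2 w') + ψ)
        (EuclideanSpace.single t (1 : ℝ)) ∂((volume : Measure (κ → ℝ)).tilted fun z => -(1 / 2 * (z ⬝ᵥ z) + U (matrixCLM A (WithLp.toLp 2 z) + ψ)))))
        ∂((volume : Measure (κ → ℝ)).tilted fun z => -(1 / 2 * (z ⬝ᵥ z) + U (matrixCLM A (WithLp.toLp 2 z) + ψ)))) - (∫ w, (U' (matrixCLM A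
        (WithLp.toLp 2 w) + ψ) (EuclideanSpace.single x (1 : ℝ)) - (∫ w', U' (matrixCLM A (WithLp.toLp 2 w') + ψ) (EuclideanSpace.single x (1 : ℝ))
        ∂((volume : Measure (κ → ℝ)).tilted fun z => -(1 / 2 * (z ⬝ᵥ z) + U (matrixCLM A (WithLp.toLp 2 z) + ψ))))) * (U' (matrixCLM A (WithLp.toLp 2
        w) + ψ) (EuclideanSpace.single y (1 : ℝ)) - (∫ w', U' (matrixCLM A (WithLp.toLp 2 w') + ψ) (EuclideanSpace.single y (1 : ℝ)) ∂((volume :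
        Measure (κ → ℝ)).tilted fun z => -(1 / 2 * (z ⬝ᵥ z) + U (matrixCLM A (WithLp.toLp 2 z) + ψ))))) ∂((volume : Measure (κ → ℝ)).tilted fun z =>
        -(1 / 2 * (z ⬝ᵥ z) + U (matrixCLM A (WithLp.toLp 2 z) + ψ)))) * (∫ w, (U' (matrixCLM A (WithLp.toLp 2 w) + ψ) (EuclideanSpace.single z (1 :
        ℝ)) - (∫ w', U' (matrixCLM A (WithLp.toLp 2 w') + ψ) (EuclideanSpace.single z (1 : ℝ)) ∂((volume : Measure (κ → ℝ)).tilted fun z => -(1 / 2 *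
        (z ⬝ᵥ z) + U (matrixCLM A (WithLp.toLp 2 z) + ψ))))) * (U' (matrixCLM A (WithLp.toLp 2 w) + ψ) (EuclideanSpace.single t (1 : ℝ)) - (∫ w', U'
        (matrixCLM A (WithLp.toLp 2 w') + ψ) (EuclideanSpace.single t (1 : ℝ)) ∂((volume : Measure (κ → ℝ)).tilted fun z => -(1 / 2 * (z ⬝ᵥ z) + U
        (matrixCLM A (WithLp.toLp 2 z) + ψ))))) ∂((volume : Measure (κ → ℝ)).tilted fun z => -(1 / 2 * (z ⬝ᵥ z) + U (matrixCLM A (WithLp.toLp 2 z) +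
        ψ)))) - (∫ w, (U' (matrixCLM A (WithLp.toLp 2 w) + ψ) (EuclideanSpace.single x (1 : ℝ)) - (∫ w', U' (matrixCLM A (WithLp.toLp 2 w') + ψ)
        (EuclideanSpace.single x (1 : ℝ)) ∂((volume : Measure (κ → ℝ)).tilted fun z => -(1 / 2 * (z ⬝ᵥ z) + U (matrixCLM A (WithLp.toLp 2 z) + ψ)))))
        * (U' (matrixCLM A (WithLp.toLp 2 w) + ψ) (EuclideanSpace.single z (1 : ℝ)) - (∫ w', U' (matrixCLM A (WithLp.toLp 2 w') + ψ)
        (EuclideanSpace.single z (1 : ℝ)) ∂((volume : Measure (κ → ℝ)).tilted fun z => -(1 / 2 * (z ⬝ᵥ z) + U (matrixCLM A (WithLp.toLp 2 z) + ψ)))))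
        ∂((volume : Measure (κ → ℝ)).tilted fun z => -(1 / 2 * (z ⬝ᵥ z) + U (matrixCLM A (WithLp.toLp 2 z) + ψ)))) * (∫ w, (U' (matrixCLM A
        (WithLp.toLp 2 w) + ψ) (EuclideanSpace.single y (1 : ℝ)) - (∫ w', U' (matrixCLM A (WithLp.toLp 2 w') + ψ) (EuclideanSpace.single y (1 : ℝ))
        ∂((volume : Measure (κ → ℝ)).tilted fun z => -(1 / 2 * (z ⬝ᵥ z) + U (matrixCLM A (WithLp.toLp 2 z) + ψ))))) * (U' (matrixCLM A (WithLp.toLp 2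
        w) + ψ) (EuclideanSpace.single t (1 : ℝ)) - (∫ w', U' (matrixCLM A (WithLp.toLp 2 w') + ψ) (EuclideanSpace.single t (1 : ℝ)) ∂((volume :
        Measure (κ → ℝ)).tilted fun z => -(1 / 2 * (z ⬝ᵥ z) + U (matrixCLM A (WithLp.toLp 2 z) + ψ))))) ∂((volume : Measure (κ → ℝ)).tilted fun z =>
        -(1 / 2 * (z ⬝ᵥ z) + U (matrixCLM A (WithLp.toLp 2 z) + ψ)))) - (∫ w, (U' (matrixCLM A (WithLp.toLp 2 w) + ψ) (EuclideanSpace.single x (1 :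
        ℝ)) - (∫ w', U' (matrixCLM A (WithLp.toLp 2 w') + ψ) (EuclideanSpace.single x (1 : ℝ)) ∂((volume : Measure (κ → ℝ)).tilted fun z => -(1 / 2 *
        (z ⬝ᵥ z) + U (matrixCLM A (WithLp.toLp 2 z) + ψ))))) * (U' (matrixCLM A (WithLp.toLp 2 w) + ψ) (EuclideanSpace.single t (1 : ℝ)) - (∫ w', U'
        (matrixCLM A (WithLp.toLp 2 w') + ψ) (EuclideanSpace.single t (1 : ℝ)) ∂((volume : Measure (κ → ℝ)).tilted fun z => -(1 / 2 * (z ⬝ᵥ z) + U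
        (matrixCLM A (WithLp.toLp 2 z) + ψ))))) ∂((volume : Measure (κ → ℝ)).tilted fun z => -(1 / 2 * (z ⬝ᵥ z) + U (matrixCLM A (WithLp.toLp 2 z) +
        ψ)))) * (∫ w, (U' (matrixCLM A (WithLp.toLp 2 w) + ψ) (EuclideanSpace.single y (1 : ℝ)) - (∫ w', U' (matrixCLM A (WithLp.toLp 2 w') + ψ)
        (EuclideanSpace.single y (1 : ℝ)) ∂((volume : Measure (κ → ℝ)).tilted fun z => -(1 / 2 * (z ⬝ᵥ z) + U (matrixCLM A (WithLp.toLp 2 z) + ψ)))))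
        * (U' (matrixCLM A (WithLp.toLp 2 w) + ψ) (EuclideanSpace.single z (1 : ℝ)) - (∫ w', U' (matrixCLM A (WithLp.toLp 2 w') + ψ)
        (EuclideanSpace.single z (1 : ℝ)) ∂((volume : Measure (κ → ℝ)).tilted fun z => -(1 / 2 * (z ⬝ᵥ z) + U (matrixCLM A (WithLp.toLp 2 z) + ψ)))))
        ∂((volume : Measure (κ → ℝ)).tilted fun z => -(1 / 2 * (z ⬝ᵥ z) + U (matrixCLM A (WithLp.toLp 2 z) + ψ))))| ≤
      (4 * ((Real.exp (8 * μ * (R + R')) * (hr * αr)) * (1 - (Real.exp (8 * μ * (2 * R + R')) * (αc * hr * αr) / (1 - lamA)))⁻¹ * ((Real.exp (8 * μ *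
          (R + R')) * (hr * αr)) * (1 - (Real.exp (8 * μ * (2 * R + R')) * (αc * hc * αr) / (1 - lamA)))⁻¹) / (1 - lamA)) + 3 * ((Real.exp (8 * μ *
          (R + R')) * (hr * αr)) * (1 - (Real.exp (8 * μ * (2 * R + R')) * (αc * hr * αr) / (1 - lamA)))⁻¹ * ((Real.exp (8 * μ * (R + R')) * (hr *
          αr)) * (1 - (Real.exp (8 * μ * (2 * R + R')) * (αc * hc * αr) / (1 - lamA)))⁻¹) / (1 - lamA)) ^ 2 + 4 * (5 * (κ₂ ^ 4 * γop ^ 2) / (1 - lam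
          * γop) ^ 2) + 4 * M₆ + 2 * (((5 * (κ₂ ^ 4 * γop ^ 2) / (1 - lam * γop) ^ 2) + 1) / 2) * ((((5 * (κ₂ ^ 4 * γop ^ 2) / (1 - lam * γop) ^ 2) +
          1) / 2) + (5 * (κ₂ ^ 4 * γop ^ 2) / (1 - lam * γop) ^ 2))) * (16 * S ^ 3) := by
  haveI : Nonempty ι := ⟨x⟩
  -- the Neumann `D` and its letters ((485)); θ ≥ 1, diagonal, submultiplicative ((476))
  have hθw1 : ∀ z w : κ, 1 ≤ (fun z w : κ => Real.exp (8 * μ * dist (q z) (q w))) z w := fun z w => expw_one_le (by linarith) (q z) (q w)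
  have hθdiag : ∀ z : κ, (fun z w : κ => Real.exp (8 * μ * dist (q z) (q w))) z z = 1 := fun z => by simp
  have hθmul : ∀ z y w : κ, (fun z w : κ => Real.exp (8 * μ * dist (q z) (q w))) z w ≤ (fun z w : κ => Real.exp (8 * μ * dist (q z) (q w))) z y *
      (fun z w : κ => Real.exp (8 * μ * dist (q z) (q w))) y w :=
    fun z y w => expw_triangle (by linarith) (q z) (q y) (q w)
  have hCθ := fun z => weighted_cross_rowsum_le hHk0 hαr hαc hhr hμ hAR hHkR hlamA1 z
  have hCθc := fun w => weighted_cross_colsum_le hHk0 hαr hαc hhc hμ hAR hHkR hlamA1 w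
  have hD := neumannD_nonneg (A := A) hHk0 hlamA1
  have hDC := neumannD_dominates (A := A) hHk0 hlamA1 hθw1 hCθ hγθ1
  have hDr := neumannD_weighted_rowsum (A := A) hHk0 hlamA1 hθw1 hθdiag hθmul hCθ hγθ1
  have hDc := neumannD_weighted_colsum (A := A) hHk0 hlamA1 hθw1 hθdiag hθmul hCθc hγθ'1
  have hdθ : 0 ≤ (1 - (Real.exp (8 * μ * (2 * R + R')) * (αc * hr * αr) / (1 - lamA)))⁻¹ := inv_nonneg.2 (by linarith)
  have hdθ' : 0 ≤ (1 - (Real.exp (8 * μ * (2 * R + R')) * (αc * hc * αr) / (1 - lamA)))⁻¹ := inv_nonneg.2 (by linarith)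
  have hαr0 : 0 ≤ αr := (Finset.sum_nonneg fun w _ => abs_nonneg (A x w)).trans (hαr x)
  have hhr0 : 0 ≤ hr := (Finset.sum_nonneg fun u _ => hHk0 x u).trans (hhr x)
  have hβ : 0 ≤ (Real.exp (8 * μ * (R + R')) * (hr * αr)) := mul_nonneg (Real.exp_pos _).le (mul_nonneg hhr0 hαr0)
  have hSc : ∀ v, ∑ u, (Real.exp (μ / 3 * dist (p u) (p v)) ^ 2)⁻¹ ≤ S := fun v => by
    have h := hS v
    simp_rw [dist_comm (p v)] at h
    exact h
  exact whitened_fourth_cumulant_row_letter (θ := (fun z w : κ => Real.exp (8 * μ * dist (q z) (q w)))) (σ := (fun x w => Real.exp (8 * μ * dist (p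
      x) (q w)))) (r := (fun x y : ι => Real.exp (μ / 3 * dist (p x) (p y))))
    (D := (fun x y : κ => ∑' n : ℕ, ((Matrix.of fun x w : κ => (if w = x then 0 else ∑ u, ∑ v, |A u w| * |A v x| * Hk v u) / (1 - lamA)) ^ n) x y))
    hΓop Y hUd hU'd hU''c hκ₀ hκ₁ ha hτ hδ hθ0 hθ1 hκθ hκθw hstab hU'b hU''b hlam hUsec hρg hHk hHk0 ψ hαr hαc hhr hlamA hlamA1 hγ hγ1 hD hDC
    (fun z w => (Real.exp_pos _).le) hDr hdθ hDc hdθ' (fun x w => (Real.exp_pos _).le) (fun x z w => sigma_theta hμ p q x z w)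
    (fun x y => expw_one_le (by linarith) (p x) (p y)) (fun x y w => r_pow_24_le hμ p q x y w)
    (fun v => weighted_obs_rowsum_le hHk0 hαr hhr hμ hAR hHkR v) hβ (fun v w => weighted_obs_entry_le hHk0 hαr hhr hμ hAR hHkR v w) hI6 hM6 hS hSc x

/-! ## §3. Toy -/

/-- Toy (§1 at distance zero): `1²⁴ ≤ e^{8μ·d}·e^{8μ·d}` with all points equal. -/
example (μ : ℝ) (hμ : 0 ≤ μ) (a : X) : Real.exp (μ / 3 * dist a a) ^ 24 ≤ Real.exp (8 * μ * dist a a) * Real.exp (8 * μ * dist a a) :=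
  r_pow_24_le (ι := Unit) (κ := Unit) hμ (fun _ => a) (fun _ => a) () () ()

end Summit.QuantumFields.BalabanUV.T4Continuum.NE7b.SupFiniteRangeFourthCumulant

end
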